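import Summits.ValiantsHypothesis.ValiantsHypothesis.Theorems.KPlusLogSqLawTridiagonalRealStaticUnitRecessiveCountSharp
import Summits.ValiantsHypothesis.ValiantsHypothesis.Theorems.KPlusLogSqLawTridiagonalRealStaticUnitDominantRules
import Summits.ValiantsHypothesis.ValiantsHypothesis.Theorems.KPlusLogSqLawTridiagonalRealStaticUnitSignTableAbove

/-!
# Route «KPlusLogSqLaw», crux `WeakLifting` (stmt-ValiantsHypothesis-19561) — REAL side of the tridiagonal sector:
# the UNIT-COEFFICIENT sub-sector — MONOTONE INERTIA ON THE WHOLE AXIS (sizes 3, 4, 5, 6, 8): zeros below any scale = Sturm count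

HONEST FRAMING.  Helper theorems (`--supports stmt-ValiantsHypothesis-19561 --as helper`), seat val-sym-lift-p1 (g19), cell `pub-symmetroid`,
2026-08-28; the gluing of `…UnitRecessiveCountSharp` (p641687: `(0,1)`), `…UnitSignTableAbove` (resonance, `V(1⁺) = ⌊(m+1)/3⌋`, cap) and
`…UnitDominantRules` (p642083: `(1,∞)`).  Continuants `D_k = pathDet (fun _ => 1) d (fun _ => 1) f k`, all edge slopes POSITIVE
(`d_k + d_{k+1} < 2f_k`), Sturm count `V(x) = #{k < m : D_k(x)D_{k+1}(x) < 0}` (= negative inertia index of the evaluated pencil).  Proved here: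
* `card_roots_window_add_sturm_eq_above_one` (`m ∈ {3,4,5,6,8}`, `1 < a < b` generic): `#zeros in (a,b) + V(a) = V(b)` — every zero above `1` is
  of negative type (top class; none for `m = 3, 5`);
* `card_roots_above_one_add_eq_sturm`: `#zeros in (1,b) + ⌊(m+1)/3⌋ = V(b)`;
* **MONOTONE INERTIA LAW** (`card_roots_below_eq_sturm_of_ne_seven`): for every one-signed unit design of size `m ∈ {3,4,5,6,8}` and every `b > 0`
  at which no continuant vanishes, THE ZEROS OF `D_m` IN `(0,b)` (with multiplicity; all simple) NUMBER EXACTLY `V(b)` — the inertia count never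
  decreases along `(0,∞)`;
* consequences (`card_posRoots_le_half`, `card_posRoots_above_one_le`, `card_posRoots_three`, `card_posRoots_five`): such a design has at most
  `⌊m/2⌋` positive zeros, at most `⌊m/2⌋ − ⌊(m+1)/3⌋ ≤ 1` of them above the resonance, and EXACTLY `1` (size 3) / `2` (size 5) positive zeros.
Size `7` is excluded: there the dominant side carries an `A`-vertex and the inertia CAN drop (located: real-slope design with zeros
`0.64, 0.92, 1.47↑, 2.73↓`, memo CROSSING-DIRECTION-liftp1g18.md §3 / seat tools/m7_dominant.py); from size `9` on the recessive side fails too.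
Nothing here is an upper law for the register (α NO MOVER); nothing bears on `WeakLifting` / `TropicalB` (stmt-19771) in their windows, Conjecture B,
the Door-A registers, `MatrixDescartes` (stmt-18050) or VP ≠ VNP.
[this seat; folklore: Sturm sequences, definite-type eigenvalue crossings]
-/

-- `Summit.ValiantsHypothesis.ValiantsHypothesis.…` repeats a component by the D-0017 layout (single-conjunct summit); the name is mandated.
set_option linter.dupNamespace false
set_option autoImplicit false

namespace Summit.ValiantsHypothesis.ValiantsHypothesis.Theorems.KPlusLogSqLaw
namespace StaticTridiagonalRealUnit

open Real Finset Polynomial Matrix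
open Summit.ValiantsHypothesis.ValiantsHypothesis.Theorems.KPlusLogSqLaw.StaticTridiagonalRealPotential (pathDet)

variable (d : ℕ → ℕ) (f : ℕ → ℕ)

/-! ### 1. The window count above the resonance -/

/-- **negative type of every zero above `1` (`m ∈ {3,4,5,6,8}`)**: sizes `3, 5` have none, sizes `4, 6, 8` only top-class ones. [this file] -/
theorem negType_above_one_of_ne_seven (m : ℕ) (hm : m = 3 ∨ m = 4 ∨ m = 5 ∨ m = 6 ∨ m = 8) (t : ℝ) (ht1 : 1 < t)
    (hslope : ∀ k, k + 1 < m → d k + d (k + 1) < 2 * f k)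
    (hroot : (pathDet (fun _ => (1 : ℝ)) d (fun _ => (1 : ℝ)) f m).eval t = 0)
    (u : Fin m → ℝ) (hu : (∑ κ, t ^ unitExponent d f m κ • unitLetter m κ) *ᵥ u = 0) (hu0 : u ≠ 0) :
    (derivative (∑ κ, C (u ⬝ᵥ (unitLetter m κ *ᵥ u)) * (X : ℝ[X]) ^ unitExponent d f m κ)).eval t < 0 := by
  rcases hm with rfl | rfl | rfl | rfl | rfl
  · exact (eval_ne_zero_above_one_three_five d f 3 (Or.inl rfl) t ht1 hslope hroot).elim
  · exact negType_above_one_of_even d f 2 (Or.inl rfl) t ht1 hslope hroot u hu hu0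
  · exact (eval_ne_zero_above_one_three_five d f 5 (Or.inr rfl) t ht1 hslope hroot).elim
  · exact negType_above_one_of_even d f 4 (Or.inr (Or.inl rfl)) t ht1 hslope hroot u hu hu0
  · exact negType_above_one_of_even d f 6 (Or.inr (Or.inr rfl)) t ht1 hslope hroot u hu hu0

/-- **EXACT WINDOW COUNT ABOVE THE RESONANCE (`m ∈ {3,4,5,6,8}`)**: all slopes positive, `1 < a < b`, no `D_k` (`k ≤ m`) vanishing at `a` or `b` ⇒
`#{zeros of D_m in (a,b), with multiplicity} + V(a) = V(b)`. [this file] -/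
theorem card_roots_window_add_sturm_eq_above_one (m : ℕ) (hm : m = 3 ∨ m = 4 ∨ m = 5 ∨ m = 6 ∨ m = 8) {a b : ℝ} (h1a : 1 < a) (hab : a < b)
    (hslope : ∀ k, k + 1 < m → d k + d (k + 1) < 2 * f k)
    (ha : ∀ k, k ≤ m → (pathDet (fun _ => (1 : ℝ)) d (fun _ => (1 : ℝ)) f k).eval a ≠ 0)
    (hb : ∀ k, k ≤ m → (pathDet (fun _ => (1 : ℝ)) d (fun _ => (1 : ℝ)) f k).eval b ≠ 0) :
    Multiset.card ((pathDet (fun _ => (1 : ℝ)) d (fun _ => (1 : ℝ)) f m).roots.filter (fun t => a < t ∧ t < b)) +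
        (Finset.univ.filter fun k : Fin m =>
          (pathDet (fun _ => (1 : ℝ)) d (fun _ => (1 : ℝ)) f k).eval a * (pathDet (fun _ => (1 : ℝ)) d (fun _ => (1 : ℝ)) f (k + 1)).eval a < 0).card =
      (Finset.univ.filter fun k : Fin m =>
          (pathDet (fun _ => (1 : ℝ)) d (fun _ => (1 : ℝ)) f k).eval b * (pathDet (fun _ => (1 : ℝ)) d (fun _ => (1 : ℝ)) f (k + 1)).eval b < 0).card := by
  classical
  have hS := unitLetter_isSymm m
  have hdet : ∀ x : ℝ, (∑ κ, x ^ unitExponent d f m κ • unitLetter m κ).det = (pathDet (fun _ => (1 : ℝ)) d (fun _ => (1 : ℝ)) f m).eval x := by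
    intro x
    rw [unitPencil_eq_ctPath, Summit.ValiantsHypothesis.ValiantsHypothesis.Theorems.KPlusLogSqLaw.SturmJacobi.det_evalPath]
  have hwin := Summit.ValiantsHypothesis.ValiantsHypothesis.Theorems.LacunarySymmetroidMatrixDescartes.Inertia.card_roots_Ioo_add_negIndex_eq_of_negType
    (unitExponent d f m) (unitLetter m) hS hab (by rw [hdet]; exact ha m le_rfl) (by rw [hdet]; exact hb m le_rfl)
    (fun t hat htb hdt u hu hu0 => negType_above_one_of_ne_seven d f m hm t (h1a.trans hat) hslope
      (by rw [← hdet]; exact hdt) u hu hu0)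
  obtain ⟨h1, -⟩ := hwin
  rw [det_unitPencil] at h1
  have hνa := Summit.ValiantsHypothesis.ValiantsHypothesis.Theorems.KPlusLogSqLaw.SturmJacobi.negIndex_eval_eq_sturmCount
    (fun _ => (1 : ℝ)) d (fun _ => (1 : ℝ)) f m (x := a) ha
  have hνb := Summit.ValiantsHypothesis.ValiantsHypothesis.Theorems.KPlusLogSqLaw.SturmJacobi.negIndex_eval_eq_sturmCount
    (fun _ => (1 : ℝ)) d (fun _ => (1 : ℝ)) f m (x := b) hb
  have ea : Fintype.card {j // (Summit.ValiantsHypothesis.ValiantsHypothesis.Theorems.LacunarySymmetroidMatrixDescartes.Inertia.isHermitian_pencil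
      (unitExponent d f m) (unitLetter m) hS a).eigenvalues j < 0} =
      (Finset.univ.filter fun k : Fin m =>
        (pathDet (fun _ => (1 : ℝ)) d (fun _ => (1 : ℝ)) f k).eval a * (pathDet (fun _ => (1 : ℝ)) d (fun _ => (1 : ℝ)) f (k + 1)).eval a < 0).card := by
    rw [negIndex_congr (unitPencil_eq_ctPath d f m a) _
      (Summit.ValiantsHypothesis.ValiantsHypothesis.Theorems.KPlusLogSqLaw.SturmJacobi.ctPathSymm_isHermitian _ _ m)]
    exact hνa
  have eb : Fintype.card {j // (Summit.ValiantsHypothesis.ValiantsHypothesis.Theorems.LacunarySymmetroidMatrixDescartes.Inertia.isHermitian_pencil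
      (unitExponent d f m) (unitLetter m) hS b).eigenvalues j < 0} =
      (Finset.univ.filter fun k : Fin m =>
        (pathDet (fun _ => (1 : ℝ)) d (fun _ => (1 : ℝ)) f k).eval b * (pathDet (fun _ => (1 : ℝ)) d (fun _ => (1 : ℝ)) f (k + 1)).eval b < 0).card := by
    rw [negIndex_congr (unitPencil_eq_ctPath d f m b) _
      (Summit.ValiantsHypothesis.ValiantsHypothesis.Theorems.KPlusLogSqLaw.SturmJacobi.ctPathSymm_isHermitian _ _ m)]
    exact hνb
  rw [ea, eb] at h1
  exact h1

/-- **ZEROS ABOVE THE RESONANCE (`m ∈ {3,4,5,6,8}`)**: all slopes positive, `b > 1` with no `D_k` (`k ≤ m`) vanishing at `b` ⇒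
`#{zeros of D_m in (1,b), with multiplicity} + ⌊(m+1)/3⌋ = V(b)`. [this file] -/
theorem card_roots_above_one_add_eq_sturm (m : ℕ) (hm : m = 3 ∨ m = 4 ∨ m = 5 ∨ m = 6 ∨ m = 8) {b : ℝ} (hb1 : 1 < b)
    (hslope : ∀ k, k + 1 < m → d k + d (k + 1) < 2 * f k)
    (hb : ∀ k, k ≤ m → (pathDet (fun _ => (1 : ℝ)) d (fun _ => (1 : ℝ)) f k).eval b ≠ 0) :
    Multiset.card ((pathDet (fun _ => (1 : ℝ)) d (fun _ => (1 : ℝ)) f m).roots.filter (fun t => 1 < t ∧ t < b)) + (m + 1) / 3 =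
      (Finset.univ.filter fun k : Fin m =>
          (pathDet (fun _ => (1 : ℝ)) d (fun _ => (1 : ℝ)) f k).eval b * (pathDet (fun _ => (1 : ℝ)) d (fun _ => (1 : ℝ)) f (k + 1)).eval b < 0).card := by
  obtain ⟨δ, hδ, htab⟩ := exists_sturmCount_above_one d f m hslope
  -- a scale `a ∈ (1, b)` inside the table zone
  set a : ℝ := min ((1 + b) / 2) (1 + δ / 2) with ha_def
  have h1a : 1 < a := by rw [ha_def]; exact lt_min (by linarith) (by linarith)
  have hab : a < b := lt_of_le_of_lt (min_le_left _ _) (by linarith)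
  have haδ : a < 1 + δ := lt_of_le_of_lt (min_le_right _ _) (by linarith)
  obtain ⟨hVa, hane⟩ := htab a h1a haδ
  have hwin := card_roots_window_add_sturm_eq_above_one d f m hm h1a hab hslope hane hb
  rw [hVa] at hwin
  rw [← hwin]
  congr 2
  refine Multiset.filter_congr fun t ht => ⟨fun h => ⟨?_, h.2⟩, fun h => ⟨h1a.trans h.1, h.2⟩⟩
  by_contra hle
  have hroot : (pathDet (fun _ => (1 : ℝ)) d (fun _ => (1 : ℝ)) f m).eval t = 0 := (mem_roots'.1 ht).2
  exact (htab t h.1 (lt_of_le_of_lt (not_lt.1 hle) haδ)).2 m le_rfl hroot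

/-! ### 2. The monotone inertia law -/

/-- splitting a window at the resonance (multiset bookkeeping). [bookkeeping] -/
theorem filter_Ioo_split (s : Multiset ℝ) {b : ℝ} (hb : 1 < b) :
    s.filter (fun t => 0 < t ∧ t < b) =
      s.filter (fun t => 0 < t ∧ t < 1) + s.filter (· = 1) + s.filter (fun t => 1 < t ∧ t < b) := by
  induction s using Multiset.induction_on with
  | empty => simp
  | cons a s ih =>
    simp only [Multiset.filter_cons, ih]
    rcases lt_trichotomy a 1 with ha | rfl | ha
    · have h2 : ¬ a = 1 := ne_of_lt ha
      have h3 : ¬ (1 < a ∧ a < b) := fun h => by linarith [h.1]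
      by_cases h0 : 0 < a
      · rw [if_pos ⟨h0, by linarith⟩, if_pos ⟨h0, ha⟩, if_neg h2, if_neg h3]; abel
      · rw [if_neg (fun h => h0 h.1), if_neg (fun h => h0 h.1), if_neg h2, if_neg h3]; abel
    · rw [if_pos ⟨one_pos, hb⟩, if_neg (fun h => lt_irrefl _ h.2), if_pos rfl, if_neg (fun h => lt_irrefl _ h.1)]; abel
    · have h1 : ¬ (0 < a ∧ a < 1) := fun h => by linarith [h.2]
      have h2 : ¬ a = 1 := ne_of_gt ha
      by_cases h0 : a < b
      · rw [if_pos ⟨by linarith, h0⟩, if_neg h1, if_neg h2, if_pos ⟨ha, h0⟩]; abel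
      · rw [if_neg (fun h => h0 h.2), if_neg h1, if_neg h2, if_neg (fun h => h0 h.2)]; abel

/-- **MONOTONE INERTIA LAW (sizes 3, 4, 5, 6, 8; all exponents)**: for every unit-coefficient static symmetric tridiagonal design with all edge
slopes positive, of size `m ∈ {3,4,5,6,8}`, and every `b > 0` at which no continuant `D_k` (`k ≤ m`) vanishes, the zeros of `D_m` in `(0,b)`
counted with multiplicity number EXACTLY the Sturm count `V(b) = #{k < m : D_k(b)D_{k+1}(b) < 0}`. [this file] -/
theorem card_roots_below_eq_sturm_of_ne_seven (m : ℕ) (hm : m = 3 ∨ m = 4 ∨ m = 5 ∨ m = 6 ∨ m = 8) {b : ℝ} (hb0 : 0 < b)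
    (hslope : ∀ k, k + 1 < m → d k + d (k + 1) < 2 * f k)
    (hb : ∀ k, k ≤ m → (pathDet (fun _ => (1 : ℝ)) d (fun _ => (1 : ℝ)) f k).eval b ≠ 0) :
    Multiset.card ((pathDet (fun _ => (1 : ℝ)) d (fun _ => (1 : ℝ)) f m).roots.filter (fun t => 0 < t ∧ t < b)) =
      (Finset.univ.filter fun k : Fin m =>
          (pathDet (fun _ => (1 : ℝ)) d (fun _ => (1 : ℝ)) f k).eval b * (pathDet (fun _ => (1 : ℝ)) d (fun _ => (1 : ℝ)) f (k + 1)).eval b < 0).card := by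
  have hm3 : 3 ≤ m := by omega
  have hm8 : m ≤ 8 := by omega
  rcases lt_trichotomy b 1 with hb1 | rfl | hb1
  · exact card_roots_below_eq_sturm_sharp d f m hm3 hm8 hb0 hb1 hslope hb
  · -- `b = 1` is never generic: `D_2(1) = 0`
    exact absurd (by rw [eval_one_eq_sign]; norm_num) (hb 2 (by omega))
  · rw [filter_Ioo_split _ hb1, Multiset.card_add, Multiset.card_add,
      card_roots_unit_interval_eq_div_three_sharp d f m hm3 hm8 hslope, Multiset.filter_eq', Multiset.card_replicate, count_roots,
      rootMultiplicity_one_eq d f m hslope]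
    have habove := card_roots_above_one_add_eq_sturm d f m hm hb1 hslope hb
    split_ifs with h <;> omega

/-! ### 3. Consequences: caps and exact totals -/

/-- a scale beyond every root of every continuant. [bookkeeping] -/
theorem exists_scale_beyond_roots (m : ℕ) (hslope : ∀ k, k + 1 < m → d k + d (k + 1) < 2 * f k) :
    ∃ b : ℝ, 1 < b ∧ (∀ k, k ≤ m → (pathDet (fun _ => (1 : ℝ)) d (fun _ => (1 : ℝ)) f k).eval b ≠ 0) ∧
      ∀ t, t ∈ (pathDet (fun _ => (1 : ℝ)) d (fun _ => (1 : ℝ)) f m).roots → t < b := by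
  classical
  -- no continuant is the zero polynomial (positive at small scales)
  have hP : ∀ k, k ≤ m → pathDet (fun _ => (1 : ℝ)) d (fun _ => (1 : ℝ)) f k ≠ 0 := by
    intro k hk h0
    have hpos : 0 < (pathDet (fun _ => (1 : ℝ)) d (fun _ => (1 : ℝ)) f k).eval (1 / 4) := by
      rcases Nat.eq_zero_or_pos k with rfl | hk0
      · rw [(eval_unit_zero_one d f _).1]; exact one_pos
      · obtain ⟨k', rfl⟩ : ∃ k', k = k' + 1 := ⟨k - 1, by omega⟩
        exact (continuant_pos_of_le_quarter d f m (1 / 4) (by norm_num) le_rfl hslope k' (by omega)).1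
    rw [h0, eval_zero] at hpos
    exact lt_irrefl _ hpos
  set b : ℝ := 2 + ∑ k ∈ range (m + 1), ((pathDet (fun _ => (1 : ℝ)) d (fun _ => (1 : ℝ)) f k).roots.map (fun t => |t|)).sum with hb_def
  have hsum_nonneg : ∀ k, 0 ≤ ((pathDet (fun _ => (1 : ℝ)) d (fun _ => (1 : ℝ)) f k).roots.map (fun t => |t|)).sum := fun k =>
    Multiset.sum_nonneg fun x hx => by
      obtain ⟨t, -, rfl⟩ := Multiset.mem_map.1 hx
      exact abs_nonneg t
  have hlt : ∀ k, k ≤ m → ∀ t, t ∈ (pathDet (fun _ => (1 : ℝ)) d (fun _ => (1 : ℝ)) f k).roots → t < b := by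
    intro k hk t ht
    have h1 : |t| ≤ ((pathDet (fun _ => (1 : ℝ)) d (fun _ => (1 : ℝ)) f k).roots.map (fun t => |t|)).sum :=
      Multiset.single_le_sum (fun x hx => by obtain ⟨t, -, rfl⟩ := Multiset.mem_map.1 hx; exact abs_nonneg t) _
        (Multiset.mem_map_of_mem _ ht)
    have h2 : ((pathDet (fun _ => (1 : ℝ)) d (fun _ => (1 : ℝ)) f k).roots.map (fun t => |t|)).sum ≤
        ∑ j ∈ range (m + 1), ((pathDet (fun _ => (1 : ℝ)) d (fun _ => (1 : ℝ)) f j).roots.map (fun t => |t|)).sum :=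
      Finset.single_le_sum (fun j _ => hsum_nonneg j) (mem_range.2 (by omega))
    have h3 : t ≤ |t| := le_abs_self t
    rw [hb_def]; linarith
  have hS : 0 ≤ ∑ k ∈ range (m + 1), ((pathDet (fun _ => (1 : ℝ)) d (fun _ => (1 : ℝ)) f k).roots.map (fun t => |t|)).sum :=
    Finset.sum_nonneg fun k _ => hsum_nonneg k
  refine ⟨b, by rw [hb_def]; linarith, fun k hk h0 => ?_, hlt m le_rfl⟩
  exact lt_irrefl _ (hlt k hk b ((mem_roots (hP k hk)).2 h0))

/-- **ONE-SIGNED CAP (`m ∈ {3,4,5,6,8}`)**: a one-signed unit design of these sizes has at most `⌊m/2⌋` positive zeros. [this file] -/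
theorem card_posRoots_le_half (m : ℕ) (hm : m = 3 ∨ m = 4 ∨ m = 5 ∨ m = 6 ∨ m = 8)
    (hslope : ∀ k, k + 1 < m → d k + d (k + 1) < 2 * f k) :
    (((pathDet (fun _ => (1 : ℝ)) d (fun _ => (1 : ℝ)) f m).roots.toFinset).filter (fun t => 0 < t)).card ≤ m / 2 := by
  classical
  obtain ⟨b, hb1, hbne, hlt⟩ := exists_scale_beyond_roots d f m hslope
  have hmono := card_roots_below_eq_sturm_of_ne_seven d f m hm (one_pos.trans hb1) hslope hbne
  have hcap := sturmCount_le_half d f m b (one_pos.trans hb1)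
  have hfilt : ((pathDet (fun _ => (1 : ℝ)) d (fun _ => (1 : ℝ)) f m).roots.toFinset).filter (fun t => 0 < t) =
      ((pathDet (fun _ => (1 : ℝ)) d (fun _ => (1 : ℝ)) f m).roots.filter (fun t => 0 < t ∧ t < b)).toFinset := by
    rw [Multiset.toFinset_filter]
    refine Finset.filter_congr fun t ht => ⟨fun h => ⟨h, hlt t (Multiset.mem_toFinset.1 ht)⟩, fun h => h.1⟩
  rw [hfilt]
  exact (Multiset.toFinset_card_le _).trans (by rw [hmono]; exact hcap)

/-- **AT MOST ONE ZERO ABOVE THE RESONANCE (`m ∈ {3,4,5,6,8}`)**: the distinct zeros of `D_m` in `(1,∞)` number at most `⌊m/2⌋ − ⌊(m+1)/3⌋`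
(`= 0` for `m = 3, 5`, `= 1` for `m = 4, 6, 8`). [this file] -/
theorem card_posRoots_above_one_le (m : ℕ) (hm : m = 3 ∨ m = 4 ∨ m = 5 ∨ m = 6 ∨ m = 8)
    (hslope : ∀ k, k + 1 < m → d k + d (k + 1) < 2 * f k) :
    (((pathDet (fun _ => (1 : ℝ)) d (fun _ => (1 : ℝ)) f m).roots.toFinset).filter (fun t => 1 < t)).card ≤ m / 2 - (m + 1) / 3 := by
  classical
  obtain ⟨b, hb1, hbne, hlt⟩ := exists_scale_beyond_roots d f m hslope
  have habove := card_roots_above_one_add_eq_sturm d f m hm hb1 hslope hbne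
  have hcap := sturmCount_le_half d f m b (one_pos.trans hb1)
  have hfilt : ((pathDet (fun _ => (1 : ℝ)) d (fun _ => (1 : ℝ)) f m).roots.toFinset).filter (fun t => 1 < t) =
      ((pathDet (fun _ => (1 : ℝ)) d (fun _ => (1 : ℝ)) f m).roots.filter (fun t => 1 < t ∧ t < b)).toFinset := by
    rw [Multiset.toFinset_filter]
    refine Finset.filter_congr fun t ht => ⟨fun h => ⟨h, hlt t (Multiset.mem_toFinset.1 ht)⟩, fun h => h.1⟩
  rw [hfilt]
  refine (Multiset.toFinset_card_le _).trans ?_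
  omega

/-- **EXACT TOTALS, sizes 3 and 5**: a one-signed unit design of size `3` has exactly ONE positive zero, of size `5` exactly TWO
(`⌊m/3⌋` below the resonance, the resonance zero for `m = 5`, none above). [this file] -/
theorem card_posRoots_three_five (m : ℕ) (hm : m = 3 ∨ m = 5)
    (hslope : ∀ k, k + 1 < m → d k + d (k + 1) < 2 * f k) :
    (((pathDet (fun _ => (1 : ℝ)) d (fun _ => (1 : ℝ)) f m).roots.toFinset).filter (fun t => 0 < t)).card = (m + 1) / 3 := by
  classical
  have hm3 : 3 ≤ m := by omega
  have hm8 : m ≤ 8 := by omega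
  have hP : pathDet (fun _ => (1 : ℝ)) d (fun _ => (1 : ℝ)) f m ≠ 0 := by
    intro h0
    obtain ⟨n, rfl⟩ : ∃ n, m = n + 1 := ⟨m - 1, by omega⟩
    have := (continuant_pos_of_le_quarter d f (n + 1) (1 / 4) (by norm_num) le_rfl hslope n (by omega)).1
    rw [h0, eval_zero] at this
    exact lt_irrefl _ this
  have hbelow := card_posRoots_unit_interval_eq_div_three_sharp d f m hm3 hm8 hslope
  -- split the positive roots at the resonance
  have hsplit : ((pathDet (fun _ => (1 : ℝ)) d (fun _ => (1 : ℝ)) f m).roots.toFinset).filter (fun t => 0 < t) =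
      ((pathDet (fun _ => (1 : ℝ)) d (fun _ => (1 : ℝ)) f m).roots.toFinset).filter (fun t => 0 < t ∧ t < 1) ∪
        ((pathDet (fun _ => (1 : ℝ)) d (fun _ => (1 : ℝ)) f m).roots.toFinset).filter (fun t => t = 1) := by
    ext t
    simp only [Finset.mem_union, Finset.mem_filter, Multiset.mem_toFinset, mem_roots hP, IsRoot.def]
    constructor
    · rintro ⟨hr, ht⟩
      rcases lt_trichotomy t 1 with h | rfl | h
      · exact Or.inl ⟨hr, ht, h⟩
      · exact Or.inr ⟨hr, rfl⟩
      · exact (eval_ne_zero_above_one_three_five d f m hm t h hslope hr).elim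
    · rintro (⟨hr, ht, -⟩ | ⟨hr, rfl⟩)
      · exact ⟨hr, ht⟩
      · exact ⟨hr, one_pos⟩
  have hdisj : Disjoint (((pathDet (fun _ => (1 : ℝ)) d (fun _ => (1 : ℝ)) f m).roots.toFinset).filter (fun t => 0 < t ∧ t < 1))
      (((pathDet (fun _ => (1 : ℝ)) d (fun _ => (1 : ℝ)) f m).roots.toFinset).filter (fun t => t = 1)) := by
    rw [Finset.disjoint_filter]
    rintro t - ⟨-, ht⟩ rfl
    exact lt_irrefl _ ht
  rw [hsplit, Finset.card_union_of_disjoint hdisj, hbelow]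
  -- the resonance contributes `[m % 3 = 2]`
  have hres : (((pathDet (fun _ => (1 : ℝ)) d (fun _ => (1 : ℝ)) f m).roots.toFinset).filter (fun t => t = 1)).card =
      if m % 3 = 2 then 1 else 0 := by
    by_cases h : m % 3 = 2
    · rw [if_pos h, Finset.card_eq_one]
      refine ⟨1, ?_⟩
      ext t
      simp only [Finset.mem_filter, Multiset.mem_toFinset, mem_roots hP, IsRoot.def, Finset.mem_singleton]
      constructor
      · rintro ⟨-, rfl⟩; rfl
      · rintro rfl; exact ⟨by rw [eval_one_eq_sign, if_pos h], rfl⟩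
    · rw [if_neg h, Finset.card_eq_zero, Finset.filter_eq_empty_iff]
      rintro t ht rfl
      rw [Multiset.mem_toFinset, mem_roots hP, IsRoot.def, eval_one_eq_sign, if_neg h] at ht
      split_ifs at ht <;> norm_num at ht
  rw [hres]
  rcases hm with rfl | rfl <;> norm_num

end StaticTridiagonalRealUnit
end Summit.ValiantsHypothesis.ValiantsHypothesis.Theorems.KPlusLogSqLaw
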